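import Summits.QuantumAdvantage.QuantumAdvantage.Theorems.WbwObfuscatedGluedTreesKowBbVocabulary
import Mathlib.Logic.Equiv.Prod
import Mathlib.Logic.Equiv.Sum
import Mathlib.Data.Fintype.BigOperators
import Mathlib.Data.Finset.Powerset
import Mathlib.Algebra.BigOperators.Ring.Finset
import Mathlib.Algebra.BigOperators.Group.Finset.Piecewise
import Mathlib.Tactic.Ring

/-!
# Stub `stub_collision` — birthday / union bound for uniformly random function tables
# (crux `WbwObfuscatedGluedTrees`, stmt-QuantumAdvantage-2340; line `knowledge-of-walk-split`, stage 5, lead c4)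

Registered stub of the stage-5 skeleton `Cruxes/WbwObfuscatedGluedTrees/Lines/knowledge_of_walk_split.lean`
(target `…KnowledgeOfWalkSplit.BlackBox.BlackBoxSoundness`).  Pure finite combinatorics, no project content is
used (the vocabulary import only fixes the place of the file in the line): for a uniformly random function
`f : A → B`, an injective family of positions `ι : V → A` and a statistic `φ : B → C` all of whose fibres have
the same size ("equidistributed"),

  `P[∃ u ≠ v, φ (f (ι u)) = φ (f (ι v))] ≤ C(|V|, 2) / |C|`,

written cross-multiplied over the counting measure on `A → B`.  It is used twice in stage 5 (tag collisions of
a uniformly random function naming; collisions of a uniformly random tag table on the vertex labels).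

Proof.  (a) One pair (`card_filter_pair_mul`): for `a ≠ a'` the functions with `φ (f a) = φ (f a')` number
exactly `|A → B| / |C|`: split `f ↦ (f a, f|_{≠ a})` along `Equiv.funSplitAt a B`; the event becomes
`{(b, g) | φ b = φ (g a')}`, of size `∑_g k = k · |{j // j ≠ a} → B|` with `k` the common fibre size, and
`k · |C| = |B|` because `B` is the disjoint union of the fibres (`Equiv.sigmaFiberEquiv`).  (b) Union bound
over the `C(|V|, 2)` two-element subsets `{u, v}` of `V` (`Finset.powersetCard 2`, `Finset.card_biUnion_le`),
each contributing the pair event of `ι u ≠ ι v`.  Degenerate cases need no separate treatment except `C = ∅`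
(then the left-hand side is `0`).
-/

set_option linter.dupNamespace false

namespace Summit.QuantumAdvantage.QuantumAdvantage.Theorems.WbwObfuscatedGluedTrees.KnowledgeOfWalk.BlackBox

open Literature.Computability.Complexity Literature.Computability.QuantumComplexity
open Literature.Computability.QuantumComplexity.GluedTrees
open Literature.Computability.Cryptography Literature.Computability.Cryptography.ObfuscatedGluedTrees

/-- Fibre bookkeeping: if every fibre of `φ : B → C` has exactly `k` elements then `k * |C| = |B|`
(`B` is the disjoint union of the fibres, `Equiv.sigmaFiberEquiv`). [folklore] -/
private theorem fibre_mul_card {B C : Type} [Fintype B] [Fintype C] [DecidableEq C] (φ : B → C) (k : ℕ)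
    (hk : ∀ c, Fintype.card {b // φ b = c} = k) : k * Fintype.card C = Fintype.card B := by
  rw [Fintype.card_congr (Equiv.sigmaFiberEquiv φ).symm, Fintype.card_sigma]
  simp only [hk, Finset.sum_const, Finset.card_univ, smul_eq_mul]
  exact Nat.mul_comm _ _

/-- One pair: for `a ≠ a'` in `A` and an equidistributed `φ : B → C` (all fibres of size `k`), the functions
`f : A → B` with `φ (f a) = φ (f a')` number exactly `|A → B| / |C|` (cross-multiplied). [folklore] -/
private theorem card_filter_pair_mul {A B C : Type} [Fintype A] [DecidableEq A] [Fintype B] [Fintype C]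
    [DecidableEq C] (φ : B → C) (k : ℕ) (hk : ∀ c, Fintype.card {b // φ b = c} = k) {a a' : A}
    (hne : a ≠ a') :
    (Finset.univ.filter fun f : A → B => φ (f a) = φ (f a')).card * Fintype.card C =
      Fintype.card (A → B) := by
  -- (1) transport along `f ↦ (f a, f|_{≠ a})`
  have h1 : (Finset.univ.filter fun f : A → B => φ (f a) = φ (f a')).card =
      (Finset.univ.filter fun p : B × ({j // j ≠ a} → B) => φ p.1 = φ (p.2 ⟨a', hne.symm⟩)).card :=
    Finset.card_equiv (Equiv.funSplitAt a B) fun f => by simp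
  -- (2) count the transported event fibrewise over the second coordinate
  have hG : ∀ g : {j // j ≠ a} → B, (∑ b : B, if φ b = φ (g ⟨a', hne.symm⟩) then 1 else 0) = k := by
    intro g
    rw [← hk (φ (g ⟨a', hne.symm⟩)), Fintype.card_subtype, Finset.card_filter]
  have h2 : (Finset.univ.filter fun p : B × ({j // j ≠ a} → B) => φ p.1 = φ (p.2 ⟨a', hne.symm⟩)).card =
      Fintype.card ({j // j ≠ a} → B) * k := by
    rw [Finset.card_filter, Fintype.sum_prod_type_right]
    exact (Finset.sum_congr rfl fun g _ => hG g).trans (by simp)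
  rw [h1, h2, Fintype.card_congr (Equiv.funSplitAt a B), Fintype.card_prod, ← fibre_mul_card φ k hk]
  ring

/-- **Stub `stub_collision`** (birthday / union bound for uniform function tables): for a uniformly random
function `f : A → B`, an injective family of positions `ι : V → A` and an equidistributed statistic `φ : B → C`
(all fibres of the same size), the probability that two distinct positions carry the same statistic is at most
`C(|V|, 2) / |C|`, cross-multiplied over the counting measure on `A → B`. [folklore] -/
theorem stub_collision : ∀ {V A B C : Type} [Fintype V] [DecidableEq V] [Fintype A] [DecidableEq A] [Fintype B]
    [Fintype C] [DecidableEq C] (ι : V → A) (φ : B → C), Function.Injective ι →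
    (∀ c₁ c₂ : C, Fintype.card {b // φ b = c₁} = Fintype.card {b // φ b = c₂}) →
    (Finset.univ.filter fun f : A → B => ∃ u v : V, u ≠ v ∧ φ (f (ι u)) = φ (f (ι v))).card * Fintype.card C ≤
      (Fintype.card V).choose 2 * Fintype.card (A → B) := by
  intro V A B C _ _ _ _ _ _ _ ι φ hι hφ
  classical
  -- `C` empty: the left-hand side vanishes
  rcases isEmpty_or_nonempty C with hC | ⟨⟨c₀⟩⟩
  · simp
  -- the common fibre size
  have hk : ∀ c, Fintype.card {b // φ b = c} = Fintype.card {b // φ b = c₀} := fun c => hφ c c₀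
  -- the "all positions of `s` collide" events, indexed by finite sets of positions
  let E : Finset V → Finset (A → B) := fun s =>
    Finset.univ.filter fun f => ∀ u ∈ s, ∀ v ∈ s, φ (f (ι u)) = φ (f (ι v))
  -- union bound: the collision event is covered by the events of the two-element sets of positions
  have hsub : (Finset.univ.filter fun f : A → B => ∃ u v : V, u ≠ v ∧ φ (f (ι u)) = φ (f (ι v))) ⊆
      (Finset.powersetCard 2 (Finset.univ : Finset V)).biUnion E := by
    intro f hf
    simp only [Finset.mem_filter, Finset.mem_univ, true_and] at hf
    obtain ⟨u, v, huv, huv'⟩ := hf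
    refine Finset.mem_biUnion.2 ⟨{u, v}, ?_, ?_⟩
    · exact Finset.mem_powersetCard.2 ⟨Finset.subset_univ _, Finset.card_pair huv⟩
    · simp only [E, Finset.mem_filter, Finset.mem_univ, true_and, Finset.mem_insert, Finset.mem_singleton]
      rintro u' (rfl | rfl) v' (rfl | rfl)
      exacts [rfl, huv', huv'.symm, rfl]
  -- each two-element event is a pair event of two distinct positions in `A`
  have hE : ∀ s ∈ Finset.powersetCard 2 (Finset.univ : Finset V),
      (E s).card * Fintype.card C ≤ Fintype.card (A → B) := by
    intro s hs
    obtain ⟨u, v, huv, rfl⟩ := Finset.card_eq_two.1 (Finset.mem_powersetCard.1 hs).2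
    calc (E {u, v}).card * Fintype.card C
        ≤ (Finset.univ.filter fun f : A → B => φ (f (ι u)) = φ (f (ι v))).card * Fintype.card C := by
          refine Nat.mul_le_mul_right _ (Finset.card_le_card fun f hf => ?_)
          simp only [E, Finset.mem_filter, Finset.mem_univ, true_and] at hf ⊢
          exact hf u (by simp) v (by simp)
      _ = Fintype.card (A → B) := card_filter_pair_mul φ _ hk (hι.ne huv)
  calc (Finset.univ.filter fun f : A → B => ∃ u v : V, u ≠ v ∧ φ (f (ι u)) = φ (f (ι v))).card *
        Fintype.card C
      ≤ ((Finset.powersetCard 2 (Finset.univ : Finset V)).biUnion E).card * Fintype.card C :=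
        Nat.mul_le_mul_right _ (Finset.card_le_card hsub)
    _ ≤ (∑ s ∈ Finset.powersetCard 2 (Finset.univ : Finset V), (E s).card) * Fintype.card C :=
        Nat.mul_le_mul_right _ Finset.card_biUnion_le
    _ = ∑ s ∈ Finset.powersetCard 2 (Finset.univ : Finset V), (E s).card * Fintype.card C := by
        rw [Finset.sum_mul]
    _ ≤ ∑ s ∈ Finset.powersetCard 2 (Finset.univ : Finset V), Fintype.card (A → B) := Finset.sum_le_sum hE
    _ = (Fintype.card V).choose 2 * Fintype.card (A → B) := by
        rw [Finset.sum_const, smul_eq_mul, Finset.card_powersetCard, Finset.card_univ]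

end Summit.QuantumAdvantage.QuantumAdvantage.Theorems.WbwObfuscatedGluedTrees.KnowledgeOfWalk.BlackBox
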